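import Mathlib
import HarnessLib
import Summits.ValiantsHypothesis.ValiantsHypothesis.Statement
import Summits.ValiantsHypothesis.ValiantsHypothesis.Theses.GirthSidon
import Summits.ValiantsHypothesis.ValiantsHypothesis.Theorems.GirthSidonMomentExponentsRelationFree

/-!
# Line `formal-direct` — crux `MomentCurveElusive` (item `stmt-ValiantsHypothesis-6534`, route `GirthSidon`)

Strategist line (crux-strategist `cstrat-stmt-ValiantsHypothesis-6534`, 2026-08-17), registered ALONGSIDE the
lead's line `Lines/birth.lean` (untouched).  It is the route's own foreseen layer-2 glue made kernel-checked and
cut at the WEAKEST family-free one-place statement: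

* `stub_monomialCurveToFormal` (provable now, S–M; numeric-to-formal transfer for MONOMIAL curves — the same
  statement, letter for letter, as `stub_monomialNumericToPuiseux` of `Lines/birth.lean`, so one proof closes
  both): if `x ↦ (x^{d_i})_{i<m}` is NOT `(s,2)`-elusive over `ℂ` then some quadratic `Γ : ℂ^s → ℂ^m` swallows
  it formally after a ramification `x = tᴺ`: `Γ_i(y) = t^{N d_i}` in `ℂ((t))`, `y ∈ ℂ((t))^s`, `N ≥ 1`.
  Inputs, all PROVED in the tree: GMOW 2019 Lemma 9.3 for monomial curves
  `Literature.Computability.AlgebraicComplexity.exists_aeval_eq_X_pow_of_not_isElusive` and the Newton–Puiseux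
  specialisation `Summit.ValiantsHypothesis.Theorems.exists_laurent_relation_transfer` (template:
  `numericToPuiseux_proof` in `Theorems/BinomialElusiveNumericToPuiseux.lean`);
* `stub_formalSwallowForcesShortRelation` (LOAD-BEARING, open) — VERBATIM the route's rank-3 crux
  `GirthSidon.FormalSwallowForcesShortRelation` (item `stmt-ValiantsHypothesis-6536`; `Iff.rfl`, see
  `stub_formal_iff_item`): a formal quadratic swallowing `Γ_i(y) = t^{D_i}` (`i < m`) with `s^10 ≤ m^9` sources
  forces multisets `S ≠ T` over `Fin m` of sizes `≤ 30` with `Σ_S D = Σ_T D`.  It is WEAKER than the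
  conjunction of `birth`'s stubs 2+3 (a sumset cover `D ⊆ U+U`, `|U|^20 ≤ m^19`, plus covering girth gives
  exactly this conclusion for injective `D`; non-injective `D` satisfy it trivially), asks only for the RELATION
  the assembly consumes, and a proof of item 6536 by anyone closes this stub and hence the leaf.

Composition `MomentCurveElusive_of` (sorry-free): for `m ≥ max m₁ 60` and `s^10 ≤ m^9`, a swallower of the
moment curve transfers to a formal swallowing of `D = N • d(m,·)`; the formal crux gives `S ≠ T` with
`Σ_S N d = Σ_T N d`, hence `Σ_S d = Σ_T d` (`N ≥ 1`); the B₃₀ property of the power-sum code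
(`momentExponentsRelationFree_proof`, item 6542, PROVED) forces `S = T` — contradiction.
`MomentCurveElusive_proof : MomentCurveElusive` applies it to the two registered stubs.

Why a second line at all (see `Lines/formal-direct.md`): (i) it records, kernel-checked, that item 6536 plus the
provable transfer closes the leaf (the route header states this glue only informally; the proved `CruxGivesTarget`
runs through the POINTWISE crux 6535 instead), so staffing on 6536 is credited to `closes`; (ii) it is the
fallback if `birth`'s stronger cover stub meets a swallowed exponent set of large cover number that still carries
short relations; (iii) the strategist's census (`STRATEGY-CENSUS.md`) lists the provable sub-regimes of the open
stub (order sets with few additive coincidences; coefficient-generic `Γ` via tropical stable intersection;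
gauge-type source spaces) as attack surface.

Disproof used: none on file for this crux (`ledger crux ls`: Lines/birth.*, PICKED.md only; no `Disproof.lean`,
no `Negative/` lemmas).  Negatives index: the only elusive-type entry, `ElusiveElusiveCandidate_refuted` (item
0340, toric swallower at `s = m − 1`), lies outside the regime `s^10 ≤ m^9` and satisfies the open stub's
conclusion (it IS a 3+3 relation), so it is an instance of, not a witness against, either stub.
-/

set_option linter.dupNamespace false

namespace Summit.ValiantsHypothesis.ValiantsHypothesis.Cruxes.MomentCurveElusive.FormalDirect

open Summit.ValiantsHypothesis.ValiantsHypothesis.Theses.GirthSidon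
open Literature.Computability.AlgebraicComplexity

/-! ## §1 The stub statements as named propositions -/

namespace Sig

/-- **Stub 1** (numeric-to-formal transfer for monomial curves; same statement as `birth`'s stub 1). -/
def stub_monomialCurveToFormal : Prop :=
    ∀ (m s : ℕ) (d : Fin m → ℕ),
      ¬ Literature.Computability.AlgebraicComplexity.IsElusive
          (fun i : Fin m => (MvPolynomial.X 0 : MvPolynomial (Fin 1) ℂ) ^ d i) s 2 →
      ∃ (N : ℕ) (Γ : Fin m → MvPolynomial (Fin s) ℂ) (y : Fin s → LaurentSeries ℂ),
        0 < N ∧ (∀ i, (Γ i).totalDegree ≤ 2) ∧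
          ∀ i, MvPolynomial.aeval y (Γ i) = HahnSeries.single ((N * d i : ℕ) : ℤ) (1 : ℂ)

/-- **Stub 2** (formal swallowing forces a short relation; VERBATIM the route's rank-3 crux, item 6536). -/
def stub_formalSwallowForcesShortRelation : Prop :=
    ∃ m₀ : ℕ, ∀ m ≥ m₀, ∀ (d : Fin m → ℕ) (s : ℕ), s ^ 10 ≤ m ^ 9 →
      ∀ (Γ : Fin m → MvPolynomial (Fin s) ℂ) (y : Fin s → LaurentSeries ℂ),
        (∀ i, (Γ i).totalDegree ≤ 2) →
        (∀ i, MvPolynomial.aeval y (Γ i) = HahnSeries.single (d i : ℤ) (1 : ℂ)) →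
        ∃ S T : Multiset (Fin m), S ≠ T ∧ Multiset.card S ≤ 30 ∧ Multiset.card T ≤ 30 ∧
          (S.map d).sum = (T.map d).sum

/-- Stub 2 is, by `Iff.rfl`, the route decl `GirthSidon.FormalSwallowForcesShortRelation` (item 6536): a proof
of the item closes the stub and conversely. -/
theorem stub_formal_iff_item :
    stub_formalSwallowForcesShortRelation ↔ FormalSwallowForcesShortRelation := Iff.rfl

end Sig

/-! ## §2 The two registered stubs (statements spelled out; `sorry` lives only here) -/

/-- **Stub 1 (numeric-to-formal transfer for monomial curves).** If the monomial curve `x ↦ (x^{d_i})_{i<m}`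
is not `(s,2)`-elusive over `ℂ`, then for some `N ≥ 1`, some quadratic `Γ` and Laurent series
`y ∈ ℂ((t))^s`, `Γ_i(y) = t^{N d_i}` for every `i`.  Why plausibly true: it IS true — GMOW 2019 Lemma 9.3
(`exists_aeval_eq_X_pow_of_not_isElusive`, proved) gives `x^{d_i} = Γ_i(b(x))` over the algebraic closure of
`ℂ(x)`, and `exists_laurent_relation_transfer` (proved, via `NewtonPuiseux_holds`) specialises every polynomial
relation along `x ↦ tᴺ`, `b ↦ y(t)`; compare `numericToPuiseux_proof`.  Identical to `birth`'s
`stub_monomialNumericToPuiseux`. [difficulty: S–M, provable now] -/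
theorem stub_monomialCurveToFormal :
    ∀ (m s : ℕ) (d : Fin m → ℕ),
      ¬ Literature.Computability.AlgebraicComplexity.IsElusive
          (fun i : Fin m => (MvPolynomial.X 0 : MvPolynomial (Fin 1) ℂ) ^ d i) s 2 →
      ∃ (N : ℕ) (Γ : Fin m → MvPolynomial (Fin s) ℂ) (y : Fin s → LaurentSeries ℂ),
        0 < N ∧ (∀ i, (Γ i).totalDegree ≤ 2) ∧
          ∀ i, MvPolynomial.aeval y (Γ i) = HahnSeries.single ((N * d i : ℕ) : ℤ) (1 : ℂ) := by
  sorry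

/-- **Stub 2 (formal swallowing forces a short relation; LOAD-BEARING, open).**  For `m ≥ m₀`, any
`d : Fin m → ℕ`, `s^10 ≤ m^9`, a quadratic `Γ : ℂ^s → ℂ^m` and `y ∈ ℂ((t))^s` with `Γ_i(y) = t^{d_i}` for all
`i`: there are multisets `S ≠ T` over `Fin m`, each of size `≤ 30`, with `Σ_S d = Σ_T d`.  VERBATIM the route's
rank-3 crux (item stmt-ValiantsHypothesis-6536).  Why plausibly true: honest coordinates (no leading
cancellation) have `d_i ∈ O + O`, `O` = the `≤ s+1` t-orders of `span(1, y)`, and the proved girth engine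
(`GirthSidonSparse.exists_relation_core`) turns `≥ 4(s+2)^{31/30}` of them into an even cycle; cancellation-born
coordinates number at most `C(s+2,2) − |O+O|` (dimension count) and every swallower on record (toric, sparse,
pencil/unit gadgets, generic dense spans) yields either few of them or an interval of them.  Why it might fail:
cascaded cancellations in dense series manufacturing `m` spread-out target monomials from `m^{0.9}` sources; no
bound on cancellation depth is on record (GMOW 2019 §9, Narayanan 2026 Rem. 2). [difficulty: open-problem] -/
theorem stub_formalSwallowForcesShortRelation :
    ∃ m₀ : ℕ, ∀ m ≥ m₀, ∀ (d : Fin m → ℕ) (s : ℕ), s ^ 10 ≤ m ^ 9 →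
      ∀ (Γ : Fin m → MvPolynomial (Fin s) ℂ) (y : Fin s → LaurentSeries ℂ),
        (∀ i, (Γ i).totalDegree ≤ 2) →
        (∀ i, MvPolynomial.aeval y (Γ i) = HahnSeries.single (d i : ℤ) (1 : ℂ)) →
        ∃ S T : Multiset (Fin m), S ≠ T ∧ Multiset.card S ≤ 30 ∧ Multiset.card T ≤ 30 ∧
          (S.map d).sum = (T.map d).sum := by
  sorry

/-! ## §3 The kernel-checked composition -/

/-- **Assembly of the line.** `stub_monomialCurveToFormal → stub_formalSwallowForcesShortRelation →
MomentCurveElusive`: for `m ≥ max m₁ 60` and `s^10 ≤ m^9`, a quadratic swallower of the moment curve transfers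
to a formal swallowing of `D = N • d(m,·)`; the formal crux gives `S ≠ T` with `Σ_S N d = Σ_T N d`, hence
`Σ_S d = Σ_T d`; the B₃₀ property of the power-sum code (`momentExponentsRelationFree_proof`, item 6542, PROVED)
forces `S = T`.  The conclusion is the route decl `GirthSidon.MomentCurveElusive` BY NAME. -/
theorem MomentCurveElusive_of :
    Sig.stub_monomialCurveToFormal → Sig.stub_formalSwallowForcesShortRelation → MomentCurveElusive := by
  rintro hT ⟨m₁, hm₁⟩
  refine ⟨max m₁ 60, fun m hm s hs => ?_⟩
  have hm1 : m₁ ≤ m := le_trans (le_max_left _ _) hm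
  have h60 : 60 ≤ m := le_trans (le_max_right _ _) hm
  by_contra hne
  -- Stub 1: a formal swallowing of `t^{N d(m,i)}`
  obtain ⟨N, Γ, y, hN, hΓ, hy⟩ :=
    hT m s (fun i : Fin m => ∑ k ∈ Finset.range 60, ((i : ℕ) + 1) ^ k * m ^ (60 * k)) hne
  -- Stub 2 applied to the scaled exponent vector `D = N • d(m,·)`
  obtain ⟨S, T, hST, hS, hT30, hsum⟩ :=
    hm₁ m hm1 (fun i : Fin m => N * ∑ k ∈ Finset.range 60, ((i : ℕ) + 1) ^ k * m ^ (60 * k))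
      s hs Γ y hΓ (fun i => hy i)
  -- cancel `N ≥ 1`
  have hsum' : (S.map fun i : Fin m => ∑ k ∈ Finset.range 60, ((i : ℕ) + 1) ^ k * m ^ (60 * k)).sum =
      (T.map fun i : Fin m => ∑ k ∈ Finset.range 60, ((i : ℕ) + 1) ^ k * m ^ (60 * k)).sum := by
    rw [Multiset.sum_map_mul_left, Multiset.sum_map_mul_left] at hsum
    exact Nat.eq_of_mul_eq_mul_left hN hsum
  -- the B₃₀ property of the power-sum code (item 6542, proved in the tree)
  exact hST (Summit.ValiantsHypothesis.ValiantsHypothesis.Theorems.momentExponentsRelationFree_proof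
    m h60 S T hS hT30 hsum')

/-- The same composition with the route item BY NAME in place of stub 2 (one proof of item 6536 closes the
leaf through this theorem). -/
theorem MomentCurveElusive_of_item :
    Sig.stub_monomialCurveToFormal → FormalSwallowForcesShortRelation → MomentCurveElusive :=
  fun h₁ h₂ => MomentCurveElusive_of h₁ (Sig.stub_formal_iff_item.2 h₂)

/-- **The skeleton**: `GirthSidon.MomentCurveElusive` BY NAME, modulo exactly the two registered stubs
(`sorry` occurs only inside `stub_monomialCurveToFormal`, `stub_formalSwallowForcesShortRelation`). -/
theorem MomentCurveElusive_proof : MomentCurveElusive :=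
  MomentCurveElusive_of stub_monomialCurveToFormal stub_formalSwallowForcesShortRelation

end Summit.ValiantsHypothesis.ValiantsHypothesis.Cruxes.MomentCurveElusive.FormalDirect
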